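import Mathlib.FieldTheory.Finite.Basic
import Mathlib.Tactic.IntervalCases
import HarnessLib

/-!
# Linear independence of the power characters of `K^×` with module coefficients (instrument, NOT a resolution theorem)

Engine 1 of the RESOLUTION OBSERVATORY toy model `W(f)` — CARVER-NOTES-eng1-g41 **T97, typed ingredient (iii)** ("linear independence of the
characters `μ ↦ μ^j` (`j mod p−1`) of `𝔽_p^×` with coefficients in any `k`-module (Vandermonde; Mathlib has the pieces around
`FiniteField.sum_pow_units`)"; RE-DERIVATION-eng1-g41 §3.7.5b (4)–(5)).  Over any finite field `K` (`q = #K`) and any `K`-module `M`: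

* `CharacterIndependence.sum_units_pow_smul_sum_pow_smul` — the extraction identity on the range `1 … q−1`: for `1 ≤ r ≤ q − 1`,
  `Σ_{μ ∈ Kˣ} μ^{q−1−r} • Σ_{s=1}^{q−1} μ^s • P s = −P r` (the only `s ∈ [1, q−1]` with `(q−1) ∣ (q−1−r+s)` is `s = r`);
* `CharacterIndependence.eq_zero_of_sum_pow_smul_eq_zero` — hence `Σ_{s=1}^{q−1} μ^s • P s = 0` for all `μ ∈ Kˣ` forces `P s = 0` for
  `1 ≤ s ≤ q − 1`;
* `CharacterIndependence.zmod_eq_zero_of_sum_pow_smul_eq_zero` — the engine's instance `K = 𝔽_p`.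

Self-contained (Mathlib's `FiniteField.sum_pow_units` only).  References: [Lang2002, Ch. V §5 (the unit group of a finite field is cyclic),
Ch. XVIII §5 (independence of characters)].  The packaging is OURS; nothing here is about resolution of singularities.
-/

namespace Literature.AlgebraicGeometry.Resolution.WeightedBlowup

namespace CharacterIndependence

variable {K : Type*} [Field K] [Fintype K] [DecidableEq K]

/-- **The extraction identity on `1 … q−1`** (ours): for `P : ℕ → M` into a `K`-module and `1 ≤ r ≤ q − 1`,
`Σ_{μ ∈ Kˣ} μ^{q−1−r} • Σ_{s=1}^{q−1} μ^s • P s = −P r`. [cite: Lang2002, Ch. V §5] -/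
theorem sum_units_pow_smul_sum_pow_smul {M : Type*} [AddCommGroup M] [Module K M] (P : ℕ → M) {r : ℕ} (hr1 : 1 ≤ r)
    (hrq : r ≤ Fintype.card K - 1) :
    ∑ μ : Kˣ, (μ : K) ^ (Fintype.card K - 1 - r) • ∑ s ∈ Finset.Icc 1 (Fintype.card K - 1), (μ : K) ^ s • P s = -P r := by
  have hchar : ∀ m : ℕ, ∑ μ : Kˣ, (μ : K) ^ m = if (Fintype.card K - 1) ∣ m then -1 else 0 :=
    fun m => FiniteField.sum_pow_units (K := K) m
  simp_rw [Finset.smul_sum, smul_smul, ← pow_add]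
  rw [Finset.sum_comm]
  simp_rw [← Finset.sum_smul]
  rw [Finset.sum_eq_single r]
  · rw [hchar, if_pos ⟨1, by omega⟩, neg_one_smul]
  · intro s hs hsr
    rw [Finset.mem_Icc] at hs
    rw [hchar, if_neg ?_, zero_smul]
    rintro ⟨m, hm⟩
    rcases Nat.lt_or_ge m 2 with hm2 | hm2
    · interval_cases m <;> omega
    · have h2 : (Fintype.card K - 1) * 2 ≤ (Fintype.card K - 1) * m := Nat.mul_le_mul_left _ hm2
      omega
  · intro hn
    exact absurd (Finset.mem_Icc.mpr ⟨hr1, hrq⟩) hn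

/-- **T97 (iii): independence of the power characters with module coefficients** (ours): if `Σ_{s=1}^{q−1} μ^s • P s = 0` for every
`μ ∈ Kˣ`, then `P s = 0` for `1 ≤ s ≤ q − 1`. [cite: Lang2002, Ch. XVIII §5] -/
theorem eq_zero_of_sum_pow_smul_eq_zero {M : Type*} [AddCommGroup M] [Module K M] (P : ℕ → M)
    (h : ∀ μ : Kˣ, ∑ s ∈ Finset.Icc 1 (Fintype.card K - 1), (μ : K) ^ s • P s = 0) :
    ∀ s, 1 ≤ s → s ≤ Fintype.card K - 1 → P s = 0 := by
  intro r hr1 hrq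
  have key := sum_units_pow_smul_sum_pow_smul P hr1 hrq
  simp only [h, smul_zero, Finset.sum_const_zero] at key
  exact neg_eq_zero.mp key.symm

/-- The engine's instance `K = 𝔽_p` (ours): for an `𝔽_p`-module `M`, `Σ_{s=1}^{p−1} μ^s • P s = 0` for all `μ ∈ 𝔽_pˣ` forces `P s = 0`
(`1 ≤ s ≤ p − 1`). [cite: Lang2002, Ch. XVIII §5] -/
theorem zmod_eq_zero_of_sum_pow_smul_eq_zero (p : ℕ) [Fact p.Prime] {M : Type*} [AddCommGroup M] [Module (ZMod p) M]
    (P : ℕ → M) (h : ∀ μ : (ZMod p)ˣ, ∑ s ∈ Finset.Icc 1 (p - 1), (μ : ZMod p) ^ s • P s = 0) :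
    ∀ s, 1 ≤ s → s ≤ p - 1 → P s = 0 := by
  have h' := eq_zero_of_sum_pow_smul_eq_zero (K := ZMod p) P (by rwa [ZMod.card])
  rwa [ZMod.card] at h'

/-- Smoke test (ours): in `𝔽_3` (`q − 1 = 2`), `μ ↦ μ` and `μ ↦ μ²` are independent: `a•μ + b•μ² = 0` for `μ = 1, 2` forces `a = b = 0`. -/
example (a b : ZMod 3) (h1 : a * 1 + b * 1 = 0) (h2 : a * 2 + b * (2 * 2) = 0) : a = 0 ∧ b = 0 := by
  revert a b; decide

end CharacterIndependence

end Literature.AlgebraicGeometry.Resolution.WeightedBlowup
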